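import Mathlib
import HarnessLib
import HarnessLib.Audit
import Summits.Langlands.Statement
import Summits.Langlands.Langlands.Theses.CoreAdequacySplit
import Summits.Langlands.Langlands.Theorems.CoreAdequacySplit
import Summits.Langlands.Langlands.Theorems.BrightMateBypass
import Summits.Langlands.Langlands.Theses.LieDefectSplit
import Summits.Langlands.Langlands.Theses.OdlyzkoWorldSplit
import Summits.Langlands.Langlands.Theorems.LieDefectSplit
import Literature.NumberTheory.GaloisRepresentations.ResidualGaloisRep
import Literature.NumberTheory.GaloisRepresentations.AdequateSubgroup
import Literature.NumberTheory.GaloisRepresentations.ExtendedAdequateSubgroup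
import Summits.Langlands.Langlands.Theses.ExtendedAdequacySplit

/-! # birth skeleton (BC3) of CORE′ = `ExtendedAdequacySplit.CoreIrreducibleNonProductLifting` (rev 1; the NEW DECLARED RESIDUAL; exempt from T3).
POST-EDIT form (use THIS file for `crux write` + `skeleton check` once the edit has landed): imports the route file and concludes the route decl BY NAME (`CoreIrreducibleNonProductLifting_proof`).
Split by RANK into the census range and the tail, exactly as rev 0's CORE skeleton (crit-cleared L1131): n ≤ 4 — the FINITE residual table with
ℓ ≤ n ((3,3) projective image A₆ ≅ PSL₂(9) ≅ Ω₃(9) [GHT17 Thm 1.7(c), Cor 9.4 (9; 3); tree `OmegaThreeNine.not_isExtendedAdequate`], (4,2) SL₂(4) ≅ A₅ on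
the Steinberg module [Cor 9.4 (4; 4)]; (2,2) EMPTY; (3,2)/(4,3) per census I-L5g13) MINUS the functorial-product lifts (¬Π: over no solvable E is ρ|_E a
twisted Sym² σ / a σ₁ ⊗ σ₂ — those are the bridge cell CPR, closed by T_Π) — versus 5 ≤ n, where Π is EMPTY (`rank_of_solvablyFunctorialProduct`: a
product shadow forces n ∈ {3,4}) and CORE′ is rev 0's CORE tail verbatim (SL₂(p) at dim (p±1)/2 ≥ 5, small-q Lie type on restricted modules with
H¹(G, ad) ≠ 0; GHT17 §§9–10).  sorries ONLY inside `stub_*`. -/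

set_option linter.dupNamespace false

namespace Summit.Langlands.Langlands.Cruxes.CoreIrreducibleNonProductLifting.Birth

open Filter

open Summit.Langlands.Langlands.Theses.ExtendedAdequacySplit (CoreIrreducibleNonProductLifting)

/-- CENSUS-RANGE stub: n ≤ 4, i.e. the rows (3,3), (4,2) (and whatever census I-L5g13 adds at (3,2), (4,3)) with the PRODUCT lifts removed.  What is
left: lifts ρ of a Sym²-type residual representation (Ω₃(9) ≅ Sym² SL₂(9)) that are NOT themselves twisted symmetric squares over any solvable E, and lifts
of a Steinberg-type residual representation (natural ⊗ Frob-natural of SL₂(4)) that are NOT tensor products over any solvable E.  No lifting theorem in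
print: GL₃/GL₄ patching needs an (extended-)adequate image, which these residual images lack on every layer; the functorial escape is exactly what ¬Π
removes.  IDEA-NEEDED (a p = 3 / p = 2 analogue of Thorne's dihedral trick forcing the deformation ring to see the Sym²/⊗ locus; potential diagonalisability
for these small images); INSTRUMENTABLE only residually (census columns X / C; Π is a property of the lift).  Residual row; size: open. -/
theorem stub_coreN_rankLe4 : ∀ (K : Type) [Field K] [NumberField K] (n : ℕ) (hcpt : Literature.NumberTheory.Automorphic.isCompact_glFiniteIntegralLevel n K), 0 < n → Summit.Langlands.Langlands.Theorems.CoreAdequacy.LiftBelow n → ∀ (ℓ : ℕ) [Fact ℓ.Prime] (ι : PadicAlgCl ℓ ≃+* ℂ) (ρ : Literature.NumberTheory.GaloisRepresentations.FramedGaloisRep K (PadicAlgCl ℓ) n), ℓ < 2 * (n + 1) → n ≤ 4 → Summit.Langlands.Langlands.Theorems.CoreAdequacy.CycIrr ρ → ¬ Summit.Langlands.Langlands.Theorems.CoreAdequacy.AdequateCyclotomicImage ρ → ¬ Summit.Langlands.Langlands.Theorems.CoreAdequacy.SolvablyAdequateImage ρ → ¬ Summit.Langlands.Langlands.Theorems.CoreAdequacy.LieDefect.SolvableDescentShadow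 ρ → ¬ Summit.Langlands.Langlands.Theorems.CoreAdequacy.LieDefect.SolvablyQuasiAdequateImage ρ → ℓ ≤ n → ¬ (∃ τ : Field.absoluteGaloisGroup (CyclotomicField ℓ K) →* Matrix.GeneralLinearGroup (Fin n) (Literature.NumberTheory.GaloisRepresentations.padicAlgClResidueField ℓ), (ρ.restrictField (CyclotomicField ℓ K)).IsReductionOf (RingHom.id (Literature.NumberTheory.GaloisRepresentations.padicAlgClResidueField ℓ)) τ ∧ Literature.NumberTheory.GaloisRepresentations.IsAbsIrreducible τ ∧ ∃ J : Subgroup (Matrix.GeneralLinearGroup (Fin n) (Literature.NumberTheory.GaloisRepresentations.padicAlgClResidueField ℓ)), Summit.Langlands.Langlands.Theorems.CoreAdequacy.LieDefect.AboveCore τ.range J ∧ J ≤ τ.range ∧ Literature.NumberTheory.GaloisRepresentations.IsAbsIrreducible J.subtype ∧ Literature.NumberTheory.GaloisRepresentations.Subgroup.IsExtendedAdequate J) → (∃ τ : Field.absoluteGaloisGroup (CyclotomicField ℓ K) →* Matrix.GeneralLinearGroup (Fin n) (Literature.NumberTheory.GaloisRepresentations.padicAlgClResidueField ℓ), (ρ.restrictField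 (CyclotomicField ℓ K)).IsReductionOf (RingHom.id (Literature.NumberTheory.GaloisRepresentations.padicAlgClResidueField ℓ)) τ ∧ Literature.NumberTheory.GaloisRepresentations.IsAbsIrreducible τ ∧ Literature.NumberTheory.GaloisRepresentations.IsAbsIrreducible (Summit.Langlands.Langlands.Theorems.CoreAdequacy.perfectCore τ.range).subtype) → ¬ (∃ (E : Type) (_ : Field E) (_ : NumberField E) (_ : Algebra K E), IsGalois K E ∧ IsSolvable (E ≃ₐ[K] E) ∧ ((∃ (σ : Literature.NumberTheory.GaloisRepresentations.FramedGaloisRep E (PadicAlgCl ℓ) 2) (χ : Literature.NumberTheory.GaloisRepresentations.FramedGaloisRep E (PadicAlgCl ℓ) 1), σ.toGaloisRep.IsIrreducible ∧ Summit.Langlands.Langlands.Theorems.CoreAdequacy.LieDefect.Geometric σ ∧ Summit.Langlands.Langlands.Theorems.CoreAdequacy.LieDefect.Geometric χ ∧ ∀ g : Field.absoluteGaloisGroup E, 2 * Literature.NumberTheory.GaloisRepresentations.FramedRep.trace (ρ.restrictField E) g = Literature.NumberTheory.GaloisRepresentations.FramedRep.trace χ g * (Literature.NumberTheory.GaloisRepresentations.FramedRep.trace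 σ g ^ 2 + Literature.NumberTheory.GaloisRepresentations.FramedRep.trace σ (g * g))) ∨ (∃ σ₁ σ₂ : Literature.NumberTheory.GaloisRepresentations.FramedGaloisRep E (PadicAlgCl ℓ) 2, σ₁.toGaloisRep.IsIrreducible ∧ σ₂.toGaloisRep.IsIrreducible ∧ Summit.Langlands.Langlands.Theorems.CoreAdequacy.LieDefect.Geometric σ₁ ∧ Summit.Langlands.Langlands.Theorems.CoreAdequacy.LieDefect.Geometric σ₂ ∧ ∀ g : Field.absoluteGaloisGroup E, Literature.NumberTheory.GaloisRepresentations.FramedRep.trace (ρ.restrictField E) g = Literature.NumberTheory.GaloisRepresentations.FramedRep.trace σ₁ g * Literature.NumberTheory.GaloisRepresentations.FramedRep.trace σ₂ g))) → ¬ Summit.Langlands.Langlands.Theorems.BrightMate.SolvablyReducible ρ → ¬ Summit.Langlands.Langlands.Theorems.BrightMate.SolvablyMated ι ρ → Summit.Langlands.Langlands.Theorems.CoreAdequacy.LiftTail K n hcpt ℓ ι ρ := by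
  sorry

/-- TAIL stub: 5 ≤ n (primes ℓ ≤ n).  Here ¬Π is automatic (`rank_of_solvablyFunctorialProduct`), so this is rev 0's tail stub verbatim in content:
infinite families of irreducible-core images without an extended-adequate layer (GHT17 Cor 9.4: SL₂(p), r = 1, modules of dimension (p ± 1)/2; small-q
Chevalley groups on restricted modules with H¹(G, V ⊗ V*) ≠ 0).  No engine, no instrument beyond n ≤ 4 at present; dark residual tail. -/
theorem stub_coreN_rankGe5 : ∀ (K : Type) [Field K] [NumberField K] (n : ℕ) (hcpt : Literature.NumberTheory.Automorphic.isCompact_glFiniteIntegralLevel n K), 0 < n → Summit.Langlands.Langlands.Theorems.CoreAdequacy.LiftBelow n → ∀ (ℓ : ℕ) [Fact ℓ.Prime] (ι : PadicAlgCl ℓ ≃+* ℂ) (ρ : Literature.NumberTheory.GaloisRepresentations.FramedGaloisRep K (PadicAlgCl ℓ) n), ℓ < 2 * (n + 1) → 5 ≤ n → Summit.Langlands.Langlands.Theorems.CoreAdequacy.CycIrr ρ → ¬ Summit.Langlands.Langlands.Theorems.CoreAdequacy.AdequateCyclotomicImage ρ → ¬ Summit.Langlands.Langlands.Theorems.CoreAdequacy.SolvablyAdequateImage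 ρ → ¬ Summit.Langlands.Langlands.Theorems.CoreAdequacy.LieDefect.SolvableDescentShadow ρ → ¬ Summit.Langlands.Langlands.Theorems.CoreAdequacy.LieDefect.SolvablyQuasiAdequateImage ρ → ℓ ≤ n → ¬ (∃ τ : Field.absoluteGaloisGroup (CyclotomicField ℓ K) →* Matrix.GeneralLinearGroup (Fin n) (Literature.NumberTheory.GaloisRepresentations.padicAlgClResidueField ℓ), (ρ.restrictField (CyclotomicField ℓ K)).IsReductionOf (RingHom.id (Literature.NumberTheory.GaloisRepresentations.padicAlgClResidueField ℓ)) τ ∧ Literature.NumberTheory.GaloisRepresentations.IsAbsIrreducible τ ∧ ∃ J : Subgroup (Matrix.GeneralLinearGroup (Fin n) (Literature.NumberTheory.GaloisRepresentations.padicAlgClResidueField ℓ)), Summit.Langlands.Langlands.Theorems.CoreAdequacy.LieDefect.AboveCore τ.range J ∧ J ≤ τ.range ∧ Literature.NumberTheory.GaloisRepresentations.IsAbsIrreducible J.subtype ∧ Literature.NumberTheory.GaloisRepresentations.Subgroup.IsExtendedAdequate J) → (∃ τ : Field.absoluteGaloisGroup (CyclotomicField ℓ K) →* Matrix.GeneralLinearGroup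 (Fin n) (Literature.NumberTheory.GaloisRepresentations.padicAlgClResidueField ℓ), (ρ.restrictField (CyclotomicField ℓ K)).IsReductionOf (RingHom.id (Literature.NumberTheory.GaloisRepresentations.padicAlgClResidueField ℓ)) τ ∧ Literature.NumberTheory.GaloisRepresentations.IsAbsIrreducible τ ∧ Literature.NumberTheory.GaloisRepresentations.IsAbsIrreducible (Summit.Langlands.Langlands.Theorems.CoreAdequacy.perfectCore τ.range).subtype) → ¬ (∃ (E : Type) (_ : Field E) (_ : NumberField E) (_ : Algebra K E), IsGalois K E ∧ IsSolvable (E ≃ₐ[K] E) ∧ ((∃ (σ : Literature.NumberTheory.GaloisRepresentations.FramedGaloisRep E (PadicAlgCl ℓ) 2) (χ : Literature.NumberTheory.GaloisRepresentations.FramedGaloisRep E (PadicAlgCl ℓ) 1), σ.toGaloisRep.IsIrreducible ∧ Summit.Langlands.Langlands.Theorems.CoreAdequacy.LieDefect.Geometric σ ∧ Summit.Langlands.Langlands.Theorems.CoreAdequacy.LieDefect.Geometric χ ∧ ∀ g : Field.absoluteGaloisGroup E, 2 * Literature.NumberTheory.GaloisRepresentations.FramedRep.trace (ρ.restrictField E)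 g = Literature.NumberTheory.GaloisRepresentations.FramedRep.trace χ g * (Literature.NumberTheory.GaloisRepresentations.FramedRep.trace σ g ^ 2 + Literature.NumberTheory.GaloisRepresentations.FramedRep.trace σ (g * g))) ∨ (∃ σ₁ σ₂ : Literature.NumberTheory.GaloisRepresentations.FramedGaloisRep E (PadicAlgCl ℓ) 2, σ₁.toGaloisRep.IsIrreducible ∧ σ₂.toGaloisRep.IsIrreducible ∧ Summit.Langlands.Langlands.Theorems.CoreAdequacy.LieDefect.Geometric σ₁ ∧ Summit.Langlands.Langlands.Theorems.CoreAdequacy.LieDefect.Geometric σ₂ ∧ ∀ g : Field.absoluteGaloisGroup E, Literature.NumberTheory.GaloisRepresentations.FramedRep.trace (ρ.restrictField E) g = Literature.NumberTheory.GaloisRepresentations.FramedRep.trace σ₁ g * Literature.NumberTheory.GaloisRepresentations.FramedRep.trace σ₂ g))) → ¬ Summit.Langlands.Langlands.Theorems.BrightMate.SolvablyReducible ρ → ¬ Summit.Langlands.Langlands.Theorems.BrightMate.SolvablyMated ι ρ → Summit.Langlands.Langlands.Theorems.CoreAdequacy.LiftTail K n hcpt ℓ ι ρ := by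
  sorry

/-- The split: RANK≤4 → RANK≥5 → CORE′ (case analysis on n ≤ 4; no other content). -/
theorem CoreIrreducibleNonProductLifting_of :
    (∀ (K : Type) [Field K] [NumberField K] (n : ℕ) (hcpt : Literature.NumberTheory.Automorphic.isCompact_glFiniteIntegralLevel n K), 0 < n → Summit.Langlands.Langlands.Theorems.CoreAdequacy.LiftBelow n → ∀ (ℓ : ℕ) [Fact ℓ.Prime] (ι : PadicAlgCl ℓ ≃+* ℂ) (ρ : Literature.NumberTheory.GaloisRepresentations.FramedGaloisRep K (PadicAlgCl ℓ) n), ℓ < 2 * (n + 1) → n ≤ 4 → Summit.Langlands.Langlands.Theorems.CoreAdequacy.CycIrr ρ → ¬ Summit.Langlands.Langlands.Theorems.CoreAdequacy.AdequateCyclotomicImage ρ → ¬ Summit.Langlands.Langlands.Theorems.CoreAdequacy.SolvablyAdequateImage ρ → ¬ Summit.Langlands.Langlands.Theorems.CoreAdequacy.LieDefect.SolvableDescentShadow ρ → ¬ Summit.Langlands.Langlands.Theorems.CoreAdequacy.LieDefect.SolvablyQuasiAdequateImage ρ → ℓ ≤ n → ¬ (∃ τ : Field.absoluteGaloisGroup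 (CyclotomicField ℓ K) →* Matrix.GeneralLinearGroup (Fin n) (Literature.NumberTheory.GaloisRepresentations.padicAlgClResidueField ℓ), (ρ.restrictField (CyclotomicField ℓ K)).IsReductionOf (RingHom.id (Literature.NumberTheory.GaloisRepresentations.padicAlgClResidueField ℓ)) τ ∧ Literature.NumberTheory.GaloisRepresentations.IsAbsIrreducible τ ∧ ∃ J : Subgroup (Matrix.GeneralLinearGroup (Fin n) (Literature.NumberTheory.GaloisRepresentations.padicAlgClResidueField ℓ)), Summit.Langlands.Langlands.Theorems.CoreAdequacy.LieDefect.AboveCore τ.range J ∧ J ≤ τ.range ∧ Literature.NumberTheory.GaloisRepresentations.IsAbsIrreducible J.subtype ∧ Literature.NumberTheory.GaloisRepresentations.Subgroup.IsExtendedAdequate J) → (∃ τ : Field.absoluteGaloisGroup (CyclotomicField ℓ K) →* Matrix.GeneralLinearGroup (Fin n) (Literature.NumberTheory.GaloisRepresentations.padicAlgClResidueField ℓ), (ρ.restrictField (CyclotomicField ℓ K)).IsReductionOf (RingHom.id (Literature.NumberTheory.GaloisRepresentations.padicAlgClResidueField ℓ)) τ ∧ Literature.NumberTheory.GaloisRepresentations.IsAbsIrreducible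 τ ∧ Literature.NumberTheory.GaloisRepresentations.IsAbsIrreducible (Summit.Langlands.Langlands.Theorems.CoreAdequacy.perfectCore τ.range).subtype) → ¬ (∃ (E : Type) (_ : Field E) (_ : NumberField E) (_ : Algebra K E), IsGalois K E ∧ IsSolvable (E ≃ₐ[K] E) ∧ ((∃ (σ : Literature.NumberTheory.GaloisRepresentations.FramedGaloisRep E (PadicAlgCl ℓ) 2) (χ : Literature.NumberTheory.GaloisRepresentations.FramedGaloisRep E (PadicAlgCl ℓ) 1), σ.toGaloisRep.IsIrreducible ∧ Summit.Langlands.Langlands.Theorems.CoreAdequacy.LieDefect.Geometric σ ∧ Summit.Langlands.Langlands.Theorems.CoreAdequacy.LieDefect.Geometric χ ∧ ∀ g : Field.absoluteGaloisGroup E, 2 * Literature.NumberTheory.GaloisRepresentations.FramedRep.trace (ρ.restrictField E) g = Literature.NumberTheory.GaloisRepresentations.FramedRep.trace χ g * (Literature.NumberTheory.GaloisRepresentations.FramedRep.trace σ g ^ 2 + Literature.NumberTheory.GaloisRepresentations.FramedRep.trace σ (g * g))) ∨ (∃ σ₁ σ₂ : Literature.NumberTheory.GaloisRepresentations.FramedGaloisRep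 E (PadicAlgCl ℓ) 2, σ₁.toGaloisRep.IsIrreducible ∧ σ₂.toGaloisRep.IsIrreducible ∧ Summit.Langlands.Langlands.Theorems.CoreAdequacy.LieDefect.Geometric σ₁ ∧ Summit.Langlands.Langlands.Theorems.CoreAdequacy.LieDefect.Geometric σ₂ ∧ ∀ g : Field.absoluteGaloisGroup E, Literature.NumberTheory.GaloisRepresentations.FramedRep.trace (ρ.restrictField E) g = Literature.NumberTheory.GaloisRepresentations.FramedRep.trace σ₁ g * Literature.NumberTheory.GaloisRepresentations.FramedRep.trace σ₂ g))) → ¬ Summit.Langlands.Langlands.Theorems.BrightMate.SolvablyReducible ρ → ¬ Summit.Langlands.Langlands.Theorems.BrightMate.SolvablyMated ι ρ → Summit.Langlands.Langlands.Theorems.CoreAdequacy.LiftTail K n hcpt ℓ ι ρ) →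
    (∀ (K : Type) [Field K] [NumberField K] (n : ℕ) (hcpt : Literature.NumberTheory.Automorphic.isCompact_glFiniteIntegralLevel n K), 0 < n → Summit.Langlands.Langlands.Theorems.CoreAdequacy.LiftBelow n → ∀ (ℓ : ℕ) [Fact ℓ.Prime] (ι : PadicAlgCl ℓ ≃+* ℂ) (ρ : Literature.NumberTheory.GaloisRepresentations.FramedGaloisRep K (PadicAlgCl ℓ) n), ℓ < 2 * (n + 1) → 5 ≤ n → Summit.Langlands.Langlands.Theorems.CoreAdequacy.CycIrr ρ → ¬ Summit.Langlands.Langlands.Theorems.CoreAdequacy.AdequateCyclotomicImage ρ → ¬ Summit.Langlands.Langlands.Theorems.CoreAdequacy.SolvablyAdequateImage ρ → ¬ Summit.Langlands.Langlands.Theorems.CoreAdequacy.LieDefect.SolvableDescentShadow ρ → ¬ Summit.Langlands.Langlands.Theorems.CoreAdequacy.LieDefect.SolvablyQuasiAdequateImage ρ → ℓ ≤ n → ¬ (∃ τ : Field.absoluteGaloisGroup (CyclotomicField ℓ K) →* Matrix.GeneralLinearGroup (Fin n) (Literature.NumberTheory.GaloisRepresentations.padicAlgClResidueField ℓ), (ρ.restrictField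 (CyclotomicField ℓ K)).IsReductionOf (RingHom.id (Literature.NumberTheory.GaloisRepresentations.padicAlgClResidueField ℓ)) τ ∧ Literature.NumberTheory.GaloisRepresentations.IsAbsIrreducible τ ∧ ∃ J : Subgroup (Matrix.GeneralLinearGroup (Fin n) (Literature.NumberTheory.GaloisRepresentations.padicAlgClResidueField ℓ)), Summit.Langlands.Langlands.Theorems.CoreAdequacy.LieDefect.AboveCore τ.range J ∧ J ≤ τ.range ∧ Literature.NumberTheory.GaloisRepresentations.IsAbsIrreducible J.subtype ∧ Literature.NumberTheory.GaloisRepresentations.Subgroup.IsExtendedAdequate J) → (∃ τ : Field.absoluteGaloisGroup (CyclotomicField ℓ K) →* Matrix.GeneralLinearGroup (Fin n) (Literature.NumberTheory.GaloisRepresentations.padicAlgClResidueField ℓ), (ρ.restrictField (CyclotomicField ℓ K)).IsReductionOf (RingHom.id (Literature.NumberTheory.GaloisRepresentations.padicAlgClResidueField ℓ)) τ ∧ Literature.NumberTheory.GaloisRepresentations.IsAbsIrreducible τ ∧ Literature.NumberTheory.GaloisRepresentations.IsAbsIrreducible (Summit.Langlands.Langlands.Theorems.CoreAdequacy.perfectCore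 τ.range).subtype) → ¬ (∃ (E : Type) (_ : Field E) (_ : NumberField E) (_ : Algebra K E), IsGalois K E ∧ IsSolvable (E ≃ₐ[K] E) ∧ ((∃ (σ : Literature.NumberTheory.GaloisRepresentations.FramedGaloisRep E (PadicAlgCl ℓ) 2) (χ : Literature.NumberTheory.GaloisRepresentations.FramedGaloisRep E (PadicAlgCl ℓ) 1), σ.toGaloisRep.IsIrreducible ∧ Summit.Langlands.Langlands.Theorems.CoreAdequacy.LieDefect.Geometric σ ∧ Summit.Langlands.Langlands.Theorems.CoreAdequacy.LieDefect.Geometric χ ∧ ∀ g : Field.absoluteGaloisGroup E, 2 * Literature.NumberTheory.GaloisRepresentations.FramedRep.trace (ρ.restrictField E) g = Literature.NumberTheory.GaloisRepresentations.FramedRep.trace χ g * (Literature.NumberTheory.GaloisRepresentations.FramedRep.trace σ g ^ 2 + Literature.NumberTheory.GaloisRepresentations.FramedRep.trace σ (g * g))) ∨ (∃ σ₁ σ₂ : Literature.NumberTheory.GaloisRepresentations.FramedGaloisRep E (PadicAlgCl ℓ) 2, σ₁.toGaloisRep.IsIrreducible ∧ σ₂.toGaloisRep.IsIrreducible ∧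 Summit.Langlands.Langlands.Theorems.CoreAdequacy.LieDefect.Geometric σ₁ ∧ Summit.Langlands.Langlands.Theorems.CoreAdequacy.LieDefect.Geometric σ₂ ∧ ∀ g : Field.absoluteGaloisGroup E, Literature.NumberTheory.GaloisRepresentations.FramedRep.trace (ρ.restrictField E) g = Literature.NumberTheory.GaloisRepresentations.FramedRep.trace σ₁ g * Literature.NumberTheory.GaloisRepresentations.FramedRep.trace σ₂ g))) → ¬ Summit.Langlands.Langlands.Theorems.BrightMate.SolvablyReducible ρ → ¬ Summit.Langlands.Langlands.Theorems.BrightMate.SolvablyMated ι ρ → Summit.Langlands.Langlands.Theorems.CoreAdequacy.LiftTail K n hcpt ℓ ι ρ) →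
    CoreIrreducibleNonProductLifting := by
  intro h4 h5 K _ _ n hcpt hn ih ℓ _ ι ρ hlt
  by_cases h : n ≤ 4
  · exact h4 K n hcpt hn ih ℓ ι ρ hlt h
  · exact h5 K n hcpt hn ih ℓ ι ρ hlt (by omega)

/-- CORE′ (the ROUTE decl, by name) from its registered stubs. -/
theorem CoreIrreducibleNonProductLifting_proof : Summit.Langlands.Langlands.Theses.ExtendedAdequacySplit.CoreIrreducibleNonProductLifting :=
  CoreIrreducibleNonProductLifting_of stub_coreN_rankLe4 stub_coreN_rankGe5

end Summit.Langlands.Langlands.Cruxes.CoreIrreducibleNonProductLifting.Birth
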